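import Literature.Algebra.Homology.GroupCohomologyRestrictScalars
import Literature.Algebra.Homology.CohomologicallyTrivial
import HarnessLib

/-!
# Tate cohomology does not see the scalars: `Ĥⁿ(G, A|_ℤ) = 0 ↔ Ĥⁿ(G, A) = 0` for all `n ∈ ℤ`,
# and `A|_ℤ` is cohomologically trivial iff `A` is

Topic `Algebra/Homology`; namespace `Literature.Algebra.Homology`; theorems only (continuing
`GroupCohomologyRestrictScalars`, which treats the ordinary groups `Hⁿ(G, A|_ℤ) ≅ Hⁿ(G, A)`);
NO named fact, no `sorry`.  Lane `lit-hodgefound` (Track 2 foundations library), seat p30 gen 18,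
row g18-#3 of `run/shared/lean/pub/lit-hodgefound/SKELETON.md`.

For a representation `A` of a finite group `G` over a commutative ring `k`, the Tate complex of
`A|_ℤ = intRep A` (same abelian group, same action, scalars `ℤ`) and the Tate complex of `A` have,
degree by degree, the same underlying abelian groups (`Fun(Gⁿ, V)` in degrees `≥ 0`, `Gⁿ →₀ V` in
degrees `< 0`) and the same differentials as functions: the standard coboundary, the standard
boundary and the norm map `N = Σ_g g` only involve the action, sums and signs `(-1)^j`
([Brown1982CohomologyGroups, III.1 Example 3; VI.4]: the complete/Tate complex is built from the
standard complexes and the norm map).  Hence exactness — vanishing of `Ĥⁿ` — is the same statement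
over `ℤ` and over `k` (`isZero_tateCohomology_intRep_iff`), for every subgroup as well
(`isCohomologicallyTrivial_intRep_iff`).  This is the dictionary by which a "`G`-module annihilated
by `p`" (Serre, *Local Fields* IX §4 Thm. 5, stated over `ℤ`) is read as a representation over
`𝐅_p` (the tree's `PGroupCohomologicallyTrivial` is stated over a field of characteristic `p`).

## What is formalised (`k G : Type`, `G` a finite group, `A : Rep k G`)

* `chainsD_intRep_apply`, `chains_d_intRep_eq` — the standard boundaries of `A` and `A|_ℤ` agree;
  `norm_intRep_apply`, `tateNorm_intRep_apply` — so do the norm maps;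
* `exact_iff_of_addEquiv` — exactness of a short complex of modules is invariant under additive
  identifications (over possibly different rings);
* **`isZero_tateCohomology_intRep_iff (n : ℤ) : IsZero (Ĥⁿ(G, A|_ℤ)) ↔ IsZero (Ĥⁿ(G, A))`**
  (four cases `n ≥ 1`, `n = 0`, `n = -1`, `n ≤ -2` of the Tate complex);
* `res_intRep` (`(A|_ℤ)|_H = (A|_H)|_ℤ`, `rfl`) and
  **`isCohomologicallyTrivial_intRep_iff : IsCohomologicallyTrivial (intRep A) ↔
  IsCohomologicallyTrivial A`**.

## References
* K. S. Brown, *Cohomology of Groups*, GTM 87 (1982), III.1 Example 3, VI.4. [Brown1982CohomologyGroups]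
* J.-P. Serre, *Local Fields*, GTM 67 (1979), IX §4 ("`G`-module annihilated by `p`"). [Serre1979]
-/

noncomputable section

open CategoryTheory CategoryTheory.Limits groupCohomology groupHomology

namespace Literature.Algebra.Homology

variable {k : Type} [CommRing k] {G : Type} [Group G] (A : Rep.{0} k G)

/-! ## §1 The standard boundaries agree -/

/-- The boundary `d : (Gⁿ⁺¹ →₀ V) → (Gⁿ →₀ V)` of `A|_ℤ` is that of `A` (same formula: action, sums,
signs). [cite: Brown1982CohomologyGroups, III.1 Example 3] -/
theorem chainsD_intRep_apply (n : ℕ) (w : (Fin (n + 1) → G) →₀ A.V) :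
    (inhomogeneousChains.d (intRep A) n w : (Fin n → G) →₀ A.V) = inhomogeneousChains.d A n w := by
  induction w using Finsupp.induction_linear with
  | zero => rw [map_zero, map_zero]
  | add x y hx hy => rw [map_add, map_add, hx, hy]
  | single g a =>
    rw [inhomogeneousChains.d_single, inhomogeneousChains.d_single]
    change Finsupp.single (fun i : Fin n => g i.succ) (A.ρ (g 0)⁻¹ a) + _ = _
    congr 1
    refine Finset.sum_congr rfl fun j _ => ?_
    rw [← Int.cast_smul_eq_zsmul k ((-1 : ℤ) ^ ((j : ℕ) + 1)), Int.cast_pow, Int.cast_neg,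
      Int.cast_one]

/-- The same for Mathlib's differentials `d i j` of the complexes of inhomogeneous chains.
[cite: Brown1982CohomologyGroups, III.1 Example 3] -/
theorem chains_d_intRep_eq (i j : ℕ) (w : (Fin i → G) →₀ A.V) :
    ((inhomogeneousChains (intRep A)).d i j w : (Fin j → G) →₀ A.V) =
      (inhomogeneousChains A).d i j w := by
  by_cases hij : j + 1 = i
  · subst hij
    rw [inhomogeneousChains.d_def, inhomogeneousChains.d_def]
    exact chainsD_intRep_apply A j w
  · have h1 := (inhomogeneousChains A).shape i j hij
    have h2 := (inhomogeneousChains (intRep A)).shape i j hij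
    rw [h1, h2]
    rfl

/-! ## §2 The norm maps agree -/

variable [Fintype G]

/-- `N_{A|_ℤ} v = N_A v` (`N = Σ_g g`). [cite: Brown1982CohomologyGroups, VI.4] -/
theorem norm_intRep_apply (v : A.V) : ((intRep A).ρ.norm v : A.V) = A.ρ.norm v := by
  rw [Representation.norm, Representation.norm, LinearMap.sum_apply, LinearMap.sum_apply]
  rfl

/-- The Tate norm maps `(G⁰ →₀ V) → (G⁰ → V)` of `A|_ℤ` and `A` agree.
[cite: Brown1982CohomologyGroups, VI.4] -/
theorem tateNorm_intRep_apply (w : (Fin 0 → G) →₀ A.V) :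
    ((intRep A).tateNorm w : (Fin 0 → G) → A.V) = A.tateNorm w := by
  rw [Rep.tateNorm_eq, Rep.tateNorm_eq]
  change (Finsupp.lsum ℤ fun _ => LinearMap.pi fun _ => (intRep A).ρ.norm) w =
    (Finsupp.lsum k fun _ => LinearMap.pi fun _ => A.ρ.norm) w
  induction w using Finsupp.induction_linear with
  | zero => rw [map_zero, map_zero]
  | add x y hx hy => rw [map_add, map_add, hx, hy]
  | single g a =>
    rw [Finsupp.lsum_single, Finsupp.lsum_single]
    funext x
    rw [LinearMap.pi_apply, LinearMap.pi_apply]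
    exact norm_intRep_apply A a

/-! ## §3 Exactness is invariant under additive identifications -/

omit [Fintype G] in
/-- If two short complexes of modules (over possibly different rings) are identified term by term
by additive bijections compatible with the maps, one is exact iff the other is (used for Brown's
remark that the standard complexes do not depend on the scalars).
[cite: Brown1982CohomologyGroups, III.1 Example 3] -/
theorem exact_iff_of_addEquiv {R S : Type} [Ring R] [Ring S] (X : ShortComplex (ModuleCat.{0} R))
    (Y : ShortComplex (ModuleCat.{0} S)) (e₁ : X.X₁ ≃+ Y.X₁) (e₂ : X.X₂ ≃+ Y.X₂)
    (e₃ : X.X₃ ≃+ Y.X₃) (h₁₂ : ∀ x, e₂ (X.f x) = Y.f (e₁ x))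
    (h₂₃ : ∀ x, e₃ (X.g x) = Y.g (e₂ x)) : X.Exact ↔ Y.Exact := by
  rw [ShortComplex.moduleCat_exact_iff, ShortComplex.moduleCat_exact_iff]
  constructor
  · intro h y hy
    obtain ⟨x, hx⟩ := h (e₂.symm y) (by
      apply e₃.injective
      rw [h₂₃, e₂.apply_symm_apply, hy, map_zero])
    refine ⟨e₁ x, ?_⟩
    rw [← h₁₂, hx, e₂.apply_symm_apply]
  · intro h x hx
    obtain ⟨y, hy⟩ := h (e₂ x) (by rw [← h₂₃, hx, map_zero])
    refine ⟨e₁.symm y, ?_⟩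
    apply e₂.injective
    rw [h₁₂, e₁.apply_symm_apply, hy]

/-! ## §4 `Ĥⁿ(G, A|_ℤ) = 0 ↔ Ĥⁿ(G, A) = 0` -/

/-- `Ĥⁿ = 0` iff the Tate complex is exact in degree `n`, read on the explicit short complex
`X^{i} → Xⁿ → X^{l}` with `i = n - 1`, `l = n + 1`. [cite: Brown1982CohomologyGroups, VI.4] -/
theorem isZero_tateCohomology_iff_exact {R : Type} [CommRing R] (M : Rep.{0} R G) (i n l : ℤ)
    (hi : i + 1 = n) (hl : n + 1 = l) :
    IsZero (tateCohomology M n) ↔ ((tateComplex M).sc' i n l).Exact := by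
  rw [← HomologicalComplex.exactAt_iff' (tateComplex M) i n l
    (by rw [CochainComplex.prev]; omega) (by rw [CochainComplex.next]; omega),
    HomologicalComplex.exactAt_iff_isZero_homology]
  rfl

/-- **`Ĥⁿ(G, A|_ℤ) = 0 ↔ Ĥⁿ(G, A) = 0` for every `n ∈ ℤ`** — the Tate complexes of `A|_ℤ` and
`A` have the same terms and the same differentials as abelian groups.
[cite: Brown1982CohomologyGroups, III.1 Example 3, VI.4] -/
theorem isZero_tateCohomology_intRep_iff (n : ℤ) :
    IsZero (tateCohomology (intRep A) n) ↔ IsZero (tateCohomology A n) := by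
  -- the four shapes of `(n - 1, n, n + 1)` in `ℤ = ℕ ⊔ -(ℕ+1)`
  cases n with
  | ofNat m =>
    cases m with
    | zero =>
      -- degrees `-1, 0, 1`: norm map, then coboundary
      rw [show Int.ofNat 0 = 0 from rfl,
        isZero_tateCohomology_iff_exact (intRep A) (-1) 0 1 (by norm_num) (by norm_num),
        isZero_tateCohomology_iff_exact A (-1) 0 1 (by norm_num) (by norm_num)]
      exact exact_iff_of_addEquiv _ _ (AddEquiv.refl _) (AddEquiv.refl _) (AddEquiv.refl _)
        (fun x => tateNorm_intRep_apply A x) (fun x => d_intRep_eq A 0 1 x)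
    | succ m =>
      -- degrees `m, m + 1, m + 2`: two coboundaries
      rw [isZero_tateCohomology_iff_exact (intRep A) (Int.ofNat m) (Int.ofNat (m + 1))
          (Int.ofNat (m + 2)) rfl rfl,
        isZero_tateCohomology_iff_exact A (Int.ofNat m) (Int.ofNat (m + 1)) (Int.ofNat (m + 2))
          rfl rfl]
      exact exact_iff_of_addEquiv _ _ (AddEquiv.refl _) (AddEquiv.refl _) (AddEquiv.refl _)
        (fun x => d_intRep_eq A m (m + 1) x) (fun x => d_intRep_eq A (m + 1) (m + 2) x)
  | negSucc m =>
    cases m with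
    | zero =>
      -- degrees `-2, -1, 0`: boundary, then norm map
      rw [isZero_tateCohomology_iff_exact (intRep A) (Int.negSucc 1) (Int.negSucc 0) 0
          (by decide) (by decide),
        isZero_tateCohomology_iff_exact A (Int.negSucc 1) (Int.negSucc 0) 0 (by decide) (by decide)]
      refine exact_iff_of_addEquiv _ _ (AddEquiv.refl _) (AddEquiv.refl _) (AddEquiv.refl _)
        (fun x => ?_) (fun x => tateNorm_intRep_apply A x)
      change ((tateComplex (intRep A)).d (Int.negSucc 1) (Int.negSucc 0) x : (Fin 0 → G) →₀ A.V) =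
        (tateComplex A).d (Int.negSucc 1) (Int.negSucc 0) x
      rw [CochainComplex.ConnectData.cochainComplex_d, CochainComplex.ConnectData.cochainComplex_d,
        CochainComplex.ConnectData.d_negSucc, CochainComplex.ConnectData.d_negSucc]
      exact chains_d_intRep_eq A 1 0 x
    | succ m =>
      -- degrees `-(m+3), -(m+2), -(m+1)`: two boundaries
      rw [isZero_tateCohomology_iff_exact (intRep A) (Int.negSucc (m + 2)) (Int.negSucc (m + 1))
          (Int.negSucc m) (by rw [Int.negSucc_eq, Int.negSucc_eq]; push_cast; ring)
          (by rw [Int.negSucc_eq, Int.negSucc_eq]; push_cast; ring),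
        isZero_tateCohomology_iff_exact A (Int.negSucc (m + 2)) (Int.negSucc (m + 1))
          (Int.negSucc m) (by rw [Int.negSucc_eq, Int.negSucc_eq]; push_cast; ring)
          (by rw [Int.negSucc_eq, Int.negSucc_eq]; push_cast; ring)]
      refine exact_iff_of_addEquiv _ _ (AddEquiv.refl _) (AddEquiv.refl _) (AddEquiv.refl _)
        (fun x => ?_) (fun x => ?_)
      · change ((tateComplex (intRep A)).d (Int.negSucc (m + 2)) (Int.negSucc (m + 1)) x :
            (Fin (m + 1) → G) →₀ A.V) =
          (tateComplex A).d (Int.negSucc (m + 2)) (Int.negSucc (m + 1)) x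
        rw [CochainComplex.ConnectData.cochainComplex_d, CochainComplex.ConnectData.cochainComplex_d,
          CochainComplex.ConnectData.d_negSucc, CochainComplex.ConnectData.d_negSucc]
        exact chains_d_intRep_eq A (m + 2) (m + 1) x
      · change ((tateComplex (intRep A)).d (Int.negSucc (m + 1)) (Int.negSucc m) x :
            (Fin m → G) →₀ A.V) =
          (tateComplex A).d (Int.negSucc (m + 1)) (Int.negSucc m) x
        rw [CochainComplex.ConnectData.cochainComplex_d, CochainComplex.ConnectData.cochainComplex_d,
          CochainComplex.ConnectData.d_negSucc, CochainComplex.ConnectData.d_negSucc]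
        exact chains_d_intRep_eq A (m + 1) m x

/-! ## §5 Cohomological triviality does not see the scalars -/

omit [Fintype G] in
/-- `(A|_ℤ)|_H = (A|_H)|_ℤ` (definitionally). [cite: Brown1982CohomologyGroups, III.1 Example 3] -/
theorem res_intRep (H : Subgroup G) : Rep.res H.subtype (intRep A) = intRep (Rep.res H.subtype A) :=
  rfl

omit [Fintype G] in
/-- **`A|_ℤ` is cohomologically trivial iff `A` is.** [cite: Brown1982CohomologyGroups, III.1 Example 3, VI.4] -/
theorem isCohomologicallyTrivial_intRep_iff :
    IsCohomologicallyTrivial (intRep A) ↔ IsCohomologicallyTrivial A := by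
  constructor
  · intro h H _ n
    exact (isZero_tateCohomology_intRep_iff (Rep.res H.subtype A) n).1 (h H n)
  · intro h H _ n
    exact (isZero_tateCohomology_intRep_iff (Rep.res H.subtype A) n).2 (h H n)

end Literature.Algebra.Homology
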